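import Mathlib

/-!
Venture QEDPrecision / cell `pub-qed`, unit `pub-qed-diag-2` (DIAG-2; written gen 2, landed gen 3 under the 2026-08-19 gate
update making `Summits/Ventures/<Topic>/**` a legal planner target). HONEST FRAMING: independent recomputation;
certified where stated, statistical where stated; no new-physics claim.  This is NEW WORK of the cell (a kernel-checked census),
not a published result: nothing here is cited as a fact anywhere; the printed comparators are named only in comments.
Staged copy: HOME/lean/diag2/NoLoopVertexGraphs.lean (HOME = run/shared/lean/pub/pub-qed/; declarations byte-identical).

# Kernel-checked counts of QED graphs without lepton loops (small orders)

The purely combinatorial model used by both diagram generators of the cell (HOME/pub-qed-diag-2/COUNTS.md,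
HOME/data/diagrams/CHECKS-2.md) and by Volkov (arXiv:1807.05281 §2; the order-10 census of 3213 graphs and its per-class table:
arXiv:1909.08015 p.9; class sizes again in arXiv:2404.00649 Table I):

* a graph of order `2n` WITHOUT lepton loops is a single open electron path whose vertices are the points
  `0, 1, …, N-1` in path order, together with photon lines = a matching of the points by pairs `(a, b)`, `a < b`;
  for a SELF-ENERGY graph `N = 2n` and the matching is perfect; for a VERTEX graph `N = 2n + 1` and exactly one
  point `X` (the external-photon vertex) is unmatched;
* the graph is ONE-PARTICLE IRREDUCIBLE iff every internal electron line — the gap between consecutive points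
  `i, i+1`, `0 ≤ i ≤ N-2` — is bridged by a photon: some pair `(a, b)` with `a ≤ i < b` (for a vertex graph this also
  forbids `X` at either end, i.e. self-energy insertions on the external legs);
* AHKN count DIRECTED graphs (the path has an orientation); Volkov counts UNDIRECTED graphs = orbits under path
  reversal `i ↦ N-1-i`.  We count orbits by canonical representatives (`key ≤ key ∘ mirror` lexicographically, where
  `key` is the partner table of the matching) and also count the mirror-symmetric graphs, so that Burnside's
  `2 · undirected = directed + symmetric` is itself checked by `decide` on the evaluated numerals.

Certified here (kernel `decide`, no `native_decide`, no axioms beyond the three standard ones):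
self-energy graphs, n = 1…5 photons: directed 1, 2, 10, 74, 706 · undirected 1, 2, 8, 47, 389 · symmetric 1, 2, 6, 20, 72;
vertex graphs, n = 1…4 (orders e², e⁴, e⁶, e⁸): directed 1, 6, 50, 518 · undirected 1, 4, 28, 269 · symmetric 1, 2, 6, 20,
and `directed = (2n-1) · selfEnergy` for n ≤ 4; and the ORDER-10 row (n = 5: directed 6354 · undirected 3213 = Volkov's `N_diag` total of arXiv:1909.08015 p.9 ·
symmetric 72, `= 9 · 706`) in `order10_values` / `order10_consistency`.  Both cell generators (diag-1 D1–D5, diag-2) and a third transfer-matrix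
count give the same numbers (HOME/pub-qed-diag-2/XCHECK.md §X-B, DIFF-LOG.md); these are the "no lepton loops" rows of AHKN's
1/7/72/891/12672 directed and of Volkov's 1/5/40/426/5536 undirected totals (the graphs WITH lepton loops are not modelled here).
-/

namespace Summit.Ventures.QEDPrecision.Diagrams

/-- All perfect matchings of an increasing list of points, as lists of pairs `(a, b)` (`a` earlier than `b`);
the first argument is fuel = number of pairs still to be formed (structural recursion). -/
def pm : ℕ → List ℕ → List (List (ℕ × ℕ))
  | 0, l => if l.isEmpty then [[]] else []
  | _ + 1, [] => []
  | k + 1, a :: rest =>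
      rest.foldr (fun b acc => ((pm k (rest.erase b)).map (fun M => (a, b) :: M)) ++ acc) []

/-- the internal electron line between points `i` and `i+1` is bridged by some photon of `M`. -/
def bridged (M : List (ℕ × ℕ)) (i : ℕ) : Bool :=
  M.any (fun e => Nat.ble e.1 i && Nat.blt i e.2)

/-- one-particle irreducibility of a graph on `N` path points: every one of the `N-1` internal lines is bridged. -/
def irreducible (N : ℕ) (M : List (ℕ × ℕ)) : Bool :=
  (List.range (N - 1)).all (bridged M)

/-- partner table of a matching on the points `0 … N-1` (an unmatched point is its own partner). -/
def partner (M : List (ℕ × ℕ)) (i : ℕ) : ℕ :=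
  match M.find? (fun e => e.1 == i || e.2 == i) with
  | some e => if e.1 == i then e.2 else e.1
  | none => i

/-- canonical key of a graph on `N` points: the partner table. -/
def key (N : ℕ) (M : List (ℕ × ℕ)) : List ℕ := (List.range N).map (partner M)

/-- key of the mirror image (path reversal `i ↦ N-1-i`). -/
def mirrorKey (N : ℕ) (L : List ℕ) : List ℕ := L.reverse.map (fun j => N - 1 - j)

/-- Boolean lexicographic `≤` on lists of naturals. -/
def lexLE : List ℕ → List ℕ → Bool
  | [], _ => true
  | _ :: _, [] => false
  | a :: s, b :: t => Nat.blt a b || (a == b && lexLE s t)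

/-- the graph is the canonical representative of its orbit under path reversal. -/
def isCanonical (N : ℕ) (M : List (ℕ × ℕ)) : Bool := lexLE (key N M) (mirrorKey N (key N M))

/-- the graph is invariant under path reversal. -/
def isSymmetric (N : ℕ) (M : List (ℕ × ℕ)) : Bool := key N M == mirrorKey N (key N M)

/-- directed 1PI self-energy graphs without lepton loops with `n` photons (points `0 … 2n-1`). -/
def selfEnergyGraphs (n : ℕ) : List (List (ℕ × ℕ)) :=
  (pm n (List.range (2 * n))).filter (irreducible (2 * n))

/-- directed 1PI vertex graphs without lepton loops with `n` photons: points `0 … 2n`, external vertex `X` unmatched. -/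
def vertexGraphs (n : ℕ) : List (List (ℕ × ℕ)) :=
  (List.range (2 * n + 1)).foldr
    (fun X acc => ((pm n ((List.range (2 * n + 1)).erase X)).filter (irreducible (2 * n + 1))) ++ acc) []

/-- number of directed 1PI self-energy graphs without lepton loops with `n` photons. -/
def selfEnergyDirected (n : ℕ) : ℕ := (selfEnergyGraphs n).length
/-- number of path-reversal orbits (undirected graphs) of 1PI self-energy graphs without lepton loops with `n` photons. -/
def selfEnergyUndirected (n : ℕ) : ℕ := ((selfEnergyGraphs n).filter (isCanonical (2 * n))).length
/-- number of mirror-symmetric 1PI self-energy graphs without lepton loops with `n` photons. -/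
def selfEnergySymmetric (n : ℕ) : ℕ := ((selfEnergyGraphs n).filter (isSymmetric (2 * n))).length
/-- number of directed 1PI vertex graphs without lepton loops with `n` internal photons (AHKN counting). -/
def vertexDirected (n : ℕ) : ℕ := (vertexGraphs n).length
/-- number of path-reversal orbits (undirected graphs) of 1PI vertex graphs without lepton loops with `n` internal photons (Volkov counting). -/
def vertexUndirected (n : ℕ) : ℕ := ((vertexGraphs n).filter (isCanonical (2 * n + 1))).length
/-- number of mirror-symmetric 1PI vertex graphs without lepton loops with `n` internal photons. -/
def vertexSymmetric (n : ℕ) : ℕ := ((vertexGraphs n).filter (isSymmetric (2 * n + 1))).length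

/-! ## sanity of the enumerator -/

/-- `pm` enumerates `(2n-1)!!` perfect matchings for `n = 1 … 5`. -/
theorem pm_card :
    (pm 1 (List.range 2)).length = 1 ∧ (pm 2 (List.range 4)).length = 3 ∧ (pm 3 (List.range 6)).length = 15 ∧
    (pm 4 (List.range 8)).length = 105 ∧ (pm 5 (List.range 10)).length = 945 := by
  decide +kernel

/-- the order-e² vertex graph and the one-loop self-energy, explicitly. -/
theorem order2_explicit : vertexGraphs 1 = [[(0, 2)]] ∧ selfEnergyGraphs 1 = [[(0, 1)]] := by decide +kernel

/-- the order-e⁴ graphs explicitly: the 2 self-energies (crossed `(0,2)(1,3)`, rainbow `(0,3)(1,2)`) and the 6 directed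
vertex graphs, listed by position of the external vertex `X = 1, 2, 3` (`X = 0, 4` give none: leg insertions). -/
theorem order4_explicit :
    selfEnergyGraphs 2 = [[(0, 2), (1, 3)], [(0, 3), (1, 2)]] ∧
    vertexGraphs 2 = [[(0, 3), (2, 4)], [(0, 4), (2, 3)], [(0, 3), (1, 4)], [(0, 4), (1, 3)],
                      [(0, 2), (1, 4)], [(0, 4), (1, 2)]] := by
  decide +kernel

/-! ## self-energy graphs (n photons, order e^{2n} self-energy) -/

/-- directed self-energy counts `1, 2, 10, 74, 706` for `n = 1 … 5` photons. -/
theorem selfEnergyDirected_values :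
    selfEnergyDirected 1 = 1 ∧ selfEnergyDirected 2 = 2 ∧ selfEnergyDirected 3 = 10 ∧
    selfEnergyDirected 4 = 74 ∧ selfEnergyDirected 5 = 706 := by
  decide +kernel

/-- undirected self-energy counts `1, 2, 8, 47, 389` for `n = 1 … 5` photons. -/
theorem selfEnergyUndirected_values :
    selfEnergyUndirected 1 = 1 ∧ selfEnergyUndirected 2 = 2 ∧ selfEnergyUndirected 3 = 8 ∧
    selfEnergyUndirected 4 = 47 ∧ selfEnergyUndirected 5 = 389 := by
  decide +kernel

/-- mirror-symmetric self-energy counts `1, 2, 6, 20, 72` for `n = 1 … 5` photons. -/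
theorem selfEnergySymmetric_values :
    selfEnergySymmetric 1 = 1 ∧ selfEnergySymmetric 2 = 2 ∧ selfEnergySymmetric 3 = 6 ∧
    selfEnergySymmetric 4 = 20 ∧ selfEnergySymmetric 5 = 72 := by
  decide +kernel

/-! ## vertex graphs (n photons + the external one, order e^{2n} contribution to a_e) -/

/-- directed vertex-graph counts `1, 6, 50, 518` for `n = 1 … 4` internal photons (orders e² … e⁸). -/
theorem vertexDirected_values :
    vertexDirected 1 = 1 ∧ vertexDirected 2 = 6 ∧ vertexDirected 3 = 50 ∧ vertexDirected 4 = 518 := by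
  decide +kernel

/-- undirected vertex-graph counts `1, 4, 28, 269` for `n = 1 … 4` internal photons (orders e² … e⁸). -/
theorem vertexUndirected_values :
    vertexUndirected 1 = 1 ∧ vertexUndirected 2 = 4 ∧ vertexUndirected 3 = 28 ∧ vertexUndirected 4 = 269 := by
  decide +kernel

/-- mirror-symmetric vertex-graph counts `1, 2, 6, 20` for `n = 1 … 4` internal photons (orders e² … e⁸). -/
theorem vertexSymmetric_values :
    vertexSymmetric 1 = 1 ∧ vertexSymmetric 2 = 2 ∧ vertexSymmetric 3 = 6 ∧ vertexSymmetric 4 = 20 := by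
  decide +kernel

/-- Burnside consistency `2 · undirected = directed + symmetric` (vertex n ≤ 4, self-energy n ≤ 5), on the evaluated numerals. -/
theorem burnside_consistency :
    (2 * vertexUndirected 1 = vertexDirected 1 + vertexSymmetric 1 ∧
     2 * vertexUndirected 2 = vertexDirected 2 + vertexSymmetric 2 ∧
     2 * vertexUndirected 3 = vertexDirected 3 + vertexSymmetric 3 ∧
     2 * vertexUndirected 4 = vertexDirected 4 + vertexSymmetric 4) ∧
    (2 * selfEnergyUndirected 1 = selfEnergyDirected 1 + selfEnergySymmetric 1 ∧
     2 * selfEnergyUndirected 2 = selfEnergyDirected 2 + selfEnergySymmetric 2 ∧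
     2 * selfEnergyUndirected 3 = selfEnergyDirected 3 + selfEnergySymmetric 3 ∧
     2 * selfEnergyUndirected 4 = selfEnergyDirected 4 + selfEnergySymmetric 4 ∧
     2 * selfEnergyUndirected 5 = selfEnergyDirected 5 + selfEnergySymmetric 5) := by
  obtain ⟨a1, a2, a3, a4⟩ := vertexDirected_values
  obtain ⟨b1, b2, b3, b4⟩ := vertexUndirected_values
  obtain ⟨c1, c2, c3, c4⟩ := vertexSymmetric_values
  obtain ⟨d1, d2, d3, d4, d5⟩ := selfEnergyDirected_values
  obtain ⟨e1, e2, e3, e4, e5⟩ := selfEnergyUndirected_values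
  obtain ⟨f1, f2, f3, f4, f5⟩ := selfEnergySymmetric_values
  refine ⟨⟨?_, ?_, ?_, ?_⟩, ?_, ?_, ?_, ?_, ?_⟩ <;> omega

/-- external-photon insertion count `directed vertex graphs = (2n-1) · directed self-energies`, n ≤ 4, on the numerals. -/
theorem vertex_eq_insertions :
    vertexDirected 1 = 1 * selfEnergyDirected 1 ∧ vertexDirected 2 = 3 * selfEnergyDirected 2 ∧
    vertexDirected 3 = 5 * selfEnergyDirected 3 ∧ vertexDirected 4 = 7 * selfEnergyDirected 4 := by
  obtain ⟨a1, a2, a3, a4⟩ := vertexDirected_values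
  obtain ⟨d1, d2, d3, d4, -⟩ := selfEnergyDirected_values
  refine ⟨?_, ?_, ?_, ?_⟩ <;> omega

/-! ## order 10 (five photons + the external one) -/

/-- The order-e¹⁰ row: 6354 directed (AHKN "no lepton loops", Set V) / 3213 undirected (Volkov 2019/2024, classes V(1)–V(9))
/ 72 mirror-symmetric vertex graphs; 10395 matchings are enumerated by the kernel. -/
theorem order10_values : vertexDirected 5 = 6354 ∧ vertexUndirected 5 = 3213 ∧ vertexSymmetric 5 = 72 := by
  decide +kernel

/-- order 10: Burnside and insertion consistency on the numerals (`2·3213 = 6354 + 72`, `6354 = 9·706`). -/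
theorem order10_consistency :
    2 * vertexUndirected 5 = vertexDirected 5 + vertexSymmetric 5 ∧ vertexDirected 5 = 9 * selfEnergyDirected 5 := by
  obtain ⟨a5, b5, c5⟩ := order10_values
  obtain ⟨-, -, -, -, d5⟩ := selfEnergyDirected_values
  constructor <;> omega

end Summit.Ventures.QEDPrecision.Diagrams
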